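import Literature.NumberTheory.Automorphic.SymplecticGroupIwasawaExponents
import HarnessLib

/-!
# The Klingen parabolic of `Sp_{2m+2}(K)`: the middle-block Levi projection `P_K → Sp_{2m}(K)`, the lift
# `Sp_{2m}(K) → Sp_{2m+2}(K)`, integrality, and the Iwasawa exponents along `P_K` (Satake 1963 §7; Cartier 1979 §IV;
# Andrianov–Zhuravlev Ch. 1 §3, Ch. 3 §3)

Topic `NumberTheory/Automorphic`; namespace `Literature.NumberTheory.Automorphic.SymplecticCartan` (lane `lit-hodgefound`,
Track 2 foundations; seat `lit-hodgefound-p11`, generation 50, row g50-#3).  DEFINITIONS with bodies (`klingenIndex`,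
`klingenBlockLabel`, `symplecticKlingenParabolic`, `klingenMid`, `klingenMidSp`, `klingenLiftMatrix`, `klingenLift`) + theorems; no
named fact, no instance, no notation.  Companion of `SymplecticSiegelParabolic` (g50-#1): the block bookkeeping behind the
KLINGEN DESCENT of the Satake transform of `Sp_{2m+2}` to the Levi `GL_1 × Sp_{2m}` of the parabolic stabilising the isotropic
line `⟨e_{inr 0}⟩` (sequel `SymplecticSatakeKlingenDescent`; Cartier's transitivity `S^G = S^M ∘ r^G_M`, [CartierCorvallis1979]
§IV proof of Thm. 4.1 (b)), for Mathlib's `symplecticGroup (Fin (m+1)) K` and the tree's Borel subgroup `symplecticBorel`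
(upper triangular for the Borel order `inr 0 < ⋯ < inr m < inl m < ⋯ < inl 0`, in which `inr 0` is FIRST and `inl 0` is LAST).

## The mathematics

Write `n = m + 1` and `ι : Fin m ⊕ Fin m ↪ Fin n ⊕ Fin n`, `inl i ↦ inl i.succ`, `inr i ↦ inr i.succ` (the "middle" indices;
`e_{inr 0}` spans the isotropic line, `e_{inl 0}` its partner: `B_J(e_{inl 0}, e_{inr 0}) = -1`).  The Klingen parabolic is
`P_K = {g ∈ Sp(J, K) : g e_{inr 0} ∈ K e_{inr 0}}`; since `g` is symplectic it then stabilises `e_{inr 0}^⊥ = ⟨e_s : s ≠ inl 0⟩`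
too, i.e. `P_K` = the symplectic matrices that are block upper triangular for the three-block label `inr 0 ↦ 0`,
middle `↦ 1`, `inl 0 ↦ 2` (`klingenBlockLabel`): `g_{s, inr 0} = 0` (`s ≠ inr 0`) and `g_{inl 0, t} = 0` (`t ≠ inl 0`).  It
contains `B(K)`; the middle block `g ↦ g|_{ι × ι}` is a HOMOMORPHISM `P_K → Sp_{2m}(K)` (multiplicative on block triangular
matrices; symplectic because in `(g J ᵗg)_{ι s, ι t} = Σ_j (g_{ι s, inr j} g_{ι t, inl j} - g_{ι s, inl j} g_{ι t, inr j})` the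
`j = 0` terms vanish), the corner entries satisfy `g_{inl 0, inl 0} g_{inr 0, inr 0} = 1`, and conversely every
`g' ∈ Sp_{2m}(K)` lifts to `L(g') = diag(1 | g' | 1) ∈ P_K` (`1` at the two corners, `g'` in the middle) with middle block
`g'`; `L(g') ∈ Sp(J, 𝒪)` iff `g'` is integral.  ALONG `P_K` THE IWASAWA EXPONENTS FACTOR: for `p ∈ P_K(K)`,
**`a(p) = (ord p_{inl 0, inl 0}; a^{(m)}(p|_{ι×ι}))`** (`a = symplecticIwasawaExp` of `Sp_{2n}`, `a^{(m)}` that of `Sp_{2m}`):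
write `p = b k` (Iwasawa), `k = b⁻¹ p ∈ Sp(J, 𝒪) ∩ P_K` has unit corners and integral middle block, `b ∈ B(K) ≤ P_K` has
`b_{inl 0, u} = 0` for `u ≠ inl 0`, so `p_{inl 0, inl 0} = b_{inl 0, inl 0} k_{inl 0, inl 0}` and `p|_{ι×ι} = b|_{ι×ι} k|_{ι×ι}`
with `b|_{ι×ι} ∈ B_m(K)` (the Borel order restricted along `ι` is the Borel order of `Sp_{2m}`, shifted by one).

## What is formalised

* §1 `klingenIndex` (`ι`), its values / injectivity / `ι s ≠ inr 0, inl 0`, `sum_eq_add_add_sum_klingenIndex`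
  (`Σ_u f u = f (inr 0) + f (inl 0) + Σ_{u'} f (ι u')`), `symplecticBorelOrder_klingenIndex` (`o_n ∘ ι = o_m + 1`),
  `J_klingenIndex` (`J_n (ι s) (ι t) = J_m s t`).
* §2 `klingenBlockLabel`, `blockTriangular_klingenBlockLabel_iff`, **`symplecticKlingenParabolic m K`**, `mem_…_iff`,
  `symplecticBorel_le_symplecticKlingenParabolic`, `mul_J_mul_transpose_apply` (the pairing `(M J ᵗN)_{xy}` as a sum),
  `apply_inl_zero_mul_apply_inr_zero` (corner entries `g_{inl 0,inl 0} g_{inr 0,inr 0} = 1`).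
* §3 `klingenMid`, `klingenMid_one`, `klingenMid_mul`, `klingenMid_mem_symplecticGroup`, **`klingenMidSp : P_K →* Sp_{2m}(K)`**,
  `coe_klingenMidSp`, `klingenMidSp_apply`, `klingenMidSp_mem_symplecticBorel` (Borel to Borel), `v_klingenMidSp_le_one`.
* §4 `klingenLiftMatrix`, its entries, `klingenLiftMatrix_mem_symplecticGroup`, **`klingenLift : Sp_{2m}(K) →* Sp_{2m+2}(K)`**,
  `klingenLift_mem_symplecticKlingenParabolic`, `klingenMidSp_klingenLift` (`L(g')|_{ι×ι} = g'`), `klingenLift_apply_inl_zero`,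
  `klingenLift_mem_symplecticInt`.
* §5 (valued `K`, uniformiser `ϖ`) `v_apply_inl_zero_eq_one_of_mem` (unit corner on `Sp(J,𝒪) ∩ P_K`),
  `symplecticIwasawaExp_klingenMidSp_of_mem_symplecticBorel`, **`symplecticIwasawaExp_succ_of_mem_klingen`**
  (`a(p)_{i+1} = a^{(m)}(p|_{ι×ι})_i`), **`v_apply_inl_zero_of_mem_klingen`** (`v(p_{inl 0, inl 0}) = exp(-a(p)_0)`),
  **`symplecticIwasawaExp_eq_cons_of_mem_klingen`**.

## References
* [Satake1963] I. Satake, *Theory of spherical functions on reductive algebraic groups over 𝔭-adic fields*, Publ. Math. IHÉS 18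
  (1963), §7 (the symplectic group), §8.
* [CartierCorvallis1979] P. Cartier, *Representations of 𝔭-adic groups: a survey*, PSPM 33.1 (1979), §IV (4.2), proof of Thm. 4.1 (b).
* [AndrianovZhuravlev1995] A. N. Andrianov, V. G. Zhuravlev, *Modular Forms and Hecke Operators*, Transl. Math. Monogr. 145 (1995),
  Ch. 1 §3 (3.5)–(3.7), Prop. 3.7; Ch. 3 §3 Lemma 3.4, §3.3 (3.44)–(3.49).
* [BruhatTits1972] F. Bruhat, J. Tits, *Groupes réductifs sur un corps local I*, Publ. Math. IHÉS 41 (1972), (4.4.3).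
-/

noncomputable section

open scoped Valued WithZero MatrixGroups
open Matrix

namespace Literature.NumberTheory.Automorphic.SymplecticCartan

open Literature.NumberTheory.Automorphic.HermitianLattice

variable {K : Type*} [Field K] {m : ℕ}

/-! ## §1 The middle indices `ι : Fin m ⊕ Fin m ↪ Fin (m+1) ⊕ Fin (m+1)` -/

/-- **The middle indices** `ι(inl i) = inl i.succ`, `ι(inr i) = inr i.succ` of `K^{(m+1) ⊔ (m+1)}`: the span of the `e_{ι s}` is
`⟨e_{inr 0}, e_{inl 0}⟩^⊥`, a symplectic space of rank `2m`. [cite: AndrianovZhuravlev1995, Ch. 1 §3 Prop. 3.7] -/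
def klingenIndex (m : ℕ) : Fin m ⊕ Fin m → Fin (m + 1) ⊕ Fin (m + 1) :=
  Sum.map Fin.succ Fin.succ

/-- `ι(inl i) = inl i.succ`. [cite: AndrianovZhuravlev1995, Ch. 1 §3 Prop. 3.7] -/
theorem klingenIndex_inl (i : Fin m) : klingenIndex m (Sum.inl i) = Sum.inl i.succ := rfl

/-- `ι(inr i) = inr i.succ`. [cite: AndrianovZhuravlev1995, Ch. 1 §3 Prop. 3.7] -/
theorem klingenIndex_inr (i : Fin m) : klingenIndex m (Sum.inr i) = Sum.inr i.succ := rfl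

/-- `ι` is injective. [cite: AndrianovZhuravlev1995, Ch. 1 §3 Prop. 3.7] -/
theorem klingenIndex_injective : Function.Injective (klingenIndex m) :=
  Sum.map_injective.2 ⟨Fin.succ_injective _, Fin.succ_injective _⟩

/-- `ι s ≠ inr 0`. [cite: AndrianovZhuravlev1995, Ch. 1 §3 Prop. 3.7] -/
theorem klingenIndex_ne_inr_zero (s : Fin m ⊕ Fin m) : klingenIndex m s ≠ Sum.inr 0 := by
  rcases s with i | i
  · exact Sum.inl_ne_inr
  · rw [klingenIndex_inr, Ne, Sum.inr.injEq]; exact Fin.succ_ne_zero i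

/-- `ι s ≠ inl 0`. [cite: AndrianovZhuravlev1995, Ch. 1 §3 Prop. 3.7] -/
theorem klingenIndex_ne_inl_zero (s : Fin m ⊕ Fin m) : klingenIndex m s ≠ Sum.inl 0 := by
  rcases s with i | i
  · rw [klingenIndex_inl, Ne, Sum.inl.injEq]; exact Fin.succ_ne_zero i
  · exact Sum.inr_ne_inl

/-- An index other than `inr 0` and `inl 0` is a middle index. [cite: AndrianovZhuravlev1995, Ch. 1 §3 Prop. 3.7] -/
theorem exists_klingenIndex_eq {x : Fin (m + 1) ⊕ Fin (m + 1)} (h1 : x ≠ Sum.inr 0) (h2 : x ≠ Sum.inl 0) :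
    ∃ s, klingenIndex m s = x := by
  rcases x with i | i
  · refine ⟨Sum.inl (i.pred fun h => h2 (by rw [h])), ?_⟩
    rw [klingenIndex_inl, Fin.succ_pred]
  · refine ⟨Sum.inr (i.pred fun h => h1 (by rw [h])), ?_⟩
    rw [klingenIndex_inr, Fin.succ_pred]

/-- **Splitting a sum over `Fin (m+1) ⊕ Fin (m+1)`**: `Σ_u f u = f (inr 0) + f (inl 0) + Σ_{u'} f (ι u')` (the three blocks of the
Klingen parabolic). [cite: AndrianovZhuravlev1995, Ch. 1 §3 Prop. 3.7] -/
theorem sum_eq_add_add_sum_klingenIndex {M : Type*} [AddCommMonoid M] (f : Fin (m + 1) ⊕ Fin (m + 1) → M) :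
    ∑ u, f u = f (Sum.inr 0) + f (Sum.inl 0) + ∑ u', f (klingenIndex m u') := by
  rw [Fintype.sum_sum_type, Fintype.sum_sum_type, Fin.sum_univ_succ, Fin.sum_univ_succ]
  simp only [klingenIndex_inl, klingenIndex_inr]
  abel

/-- **The Borel order along `ι` is the Borel order of `Sp_{2m}` shifted by one**: `o_{m+1}(ι s) = o_m(s) + 1`.
[cite: AndrianovZhuravlev1995, Ch. 1 §3 Prop. 3.7] -/
theorem symplecticBorelOrder_klingenIndex (s : Fin m ⊕ Fin m) :
    symplecticBorelOrder (m + 1) (klingenIndex m s) = symplecticBorelOrder m s + 1 := by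
  rcases s with i | i
  · rw [klingenIndex_inl, symplecticBorelOrder_inl, symplecticBorelOrder_inl, Fin.val_succ]
    have := i.isLt
    omega
  · rw [klingenIndex_inr, symplecticBorelOrder_inr, symplecticBorelOrder_inr, Fin.val_succ]

/-- `J_{m+1}(ι s, ι t) = J_m(s, t)`: the middle block of `J` is `J`. [cite: AndrianovZhuravlev1995, Ch. 1 §3 (3.1)] -/
theorem J_klingenIndex (s t : Fin m ⊕ Fin m) :
    Matrix.J (Fin (m + 1)) K (klingenIndex m s) (klingenIndex m t) = Matrix.J (Fin m) K s t := by
  rcases s with i | i <;> rcases t with j | j <;>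
    simp [klingenIndex_inl, klingenIndex_inr, Matrix.J, Matrix.fromBlocks_apply₁₁, Matrix.fromBlocks_apply₁₂,
      Matrix.fromBlocks_apply₂₁, Matrix.fromBlocks_apply₂₂, Matrix.one_apply, Fin.succ_inj]

/-! ## §2 The Klingen parabolic `P_K(K) ≤ Sp(J, K)` -/

/-- The **Klingen block label**: `inr 0 ↦ 0` (the isotropic line), middle indices `↦ 1`, `inl 0 ↦ 2` (the partner line).
[cite: AndrianovZhuravlev1995, Ch. 1 §3 Prop. 3.7] -/
def klingenBlockLabel (m : ℕ) : Fin (m + 1) ⊕ Fin (m + 1) → ℕ :=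
  Sum.elim (fun i => if i = 0 then 2 else 1) (fun i => if i = 0 then 0 else 1)

/-- `ℓ(inr 0) = 0`. [cite: AndrianovZhuravlev1995, Ch. 1 §3 Prop. 3.7] -/
@[simp] theorem klingenBlockLabel_inr_zero : klingenBlockLabel m (Sum.inr 0) = 0 := by
  simp [klingenBlockLabel]

/-- `ℓ(inl 0) = 2`. [cite: AndrianovZhuravlev1995, Ch. 1 §3 Prop. 3.7] -/
@[simp] theorem klingenBlockLabel_inl_zero : klingenBlockLabel m (Sum.inl 0) = 2 := by
  simp [klingenBlockLabel]

/-- `ℓ(ι s) = 1`. [cite: AndrianovZhuravlev1995, Ch. 1 §3 Prop. 3.7] -/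
@[simp] theorem klingenBlockLabel_klingenIndex (s : Fin m ⊕ Fin m) : klingenBlockLabel m (klingenIndex m s) = 1 := by
  rcases s with i | i
  · simp [klingenBlockLabel, klingenIndex_inl, Fin.succ_ne_zero]
  · simp [klingenBlockLabel, klingenIndex_inr, Fin.succ_ne_zero]

/-- The label of an index other than `inr 0`, `inl 0` is `1`. [cite: AndrianovZhuravlev1995, Ch. 1 §3 Prop. 3.7] -/
theorem klingenBlockLabel_of_ne {x : Fin (m + 1) ⊕ Fin (m + 1)} (h1 : x ≠ Sum.inr 0) (h2 : x ≠ Sum.inl 0) :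
    klingenBlockLabel m x = 1 := by
  obtain ⟨s, rfl⟩ := exists_klingenIndex_eq h1 h2
  exact klingenBlockLabel_klingenIndex s

/-- **Block upper triangularity for the Klingen label**: the column of `inr 0` vanishes off the diagonal and the row of `inl 0`
vanishes off the diagonal. [cite: AndrianovZhuravlev1995, Ch. 1 §3 Prop. 3.7] -/
theorem blockTriangular_klingenBlockLabel_iff {R : Type*} [Zero R] (M : Matrix (Fin (m + 1) ⊕ Fin (m + 1)) (Fin (m + 1) ⊕ Fin (m + 1)) R) :
    M.BlockTriangular (klingenBlockLabel m) ↔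
      (∀ s, s ≠ Sum.inr 0 → M s (Sum.inr 0) = 0) ∧ ∀ t, t ≠ Sum.inl 0 → M (Sum.inl 0) t = 0 := by
  constructor
  · intro h
    refine ⟨fun s hs => h ?_, fun t ht => h ?_⟩
    · rw [klingenBlockLabel_inr_zero]
      by_cases hs' : s = Sum.inl 0
      · rw [hs', klingenBlockLabel_inl_zero]; exact Nat.zero_lt_two
      · rw [klingenBlockLabel_of_ne hs hs']; exact Nat.zero_lt_one
    · rw [klingenBlockLabel_inl_zero]
      by_cases ht' : t = Sum.inr 0
      · rw [ht', klingenBlockLabel_inr_zero]; exact Nat.zero_lt_two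
      · rw [klingenBlockLabel_of_ne ht' ht]; exact Nat.one_lt_two
  · rintro ⟨h1, h2⟩ s t hst
    by_cases ht : t = Sum.inr 0
    · subst ht
      exact h1 s (by rintro rfl; exact lt_irrefl _ hst)
    by_cases hs : s = Sum.inl 0
    · subst hs
      exact h2 t (by rintro rfl; exact lt_irrefl _ hst)
    · exfalso
      have hls : klingenBlockLabel m s ≤ 1 := by
        by_cases hs' : s = Sum.inr 0
        · rw [hs', klingenBlockLabel_inr_zero]; exact Nat.zero_le _
        · rw [klingenBlockLabel_of_ne hs' hs]
      have hlt : 1 ≤ klingenBlockLabel m t := by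
        by_cases ht' : t = Sum.inl 0
        · rw [ht', klingenBlockLabel_inl_zero]; exact one_le_two
        · rw [klingenBlockLabel_of_ne ht ht']
      omega

/-- **The Klingen parabolic `P_K(K) ≤ Sp(J, K)`** (`n = m + 1`): the stabiliser of the isotropic line `⟨e_{inr 0}⟩` (and then of
its orthogonal `⟨e_s : s ≠ inl 0⟩`); Levi `GL_1 × Sp_{2m}`. [cite: AndrianovZhuravlev1995, Ch. 1 §3 Prop. 3.7] [cite: Satake1963, §7] -/
def symplecticKlingenParabolic (m : ℕ) (K : Type*) [Field K] : Subgroup (symplecticGroup (Fin (m + 1)) K) where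
  carrier := {g | (g : Matrix (Fin (m + 1) ⊕ Fin (m + 1)) (Fin (m + 1) ⊕ Fin (m + 1)) K).BlockTriangular (klingenBlockLabel m)}
  mul_mem' {a b} ha hb := by
    change ((a * b : symplecticGroup (Fin (m + 1)) K) : Matrix (Fin (m + 1) ⊕ Fin (m + 1)) (Fin (m + 1) ⊕ Fin (m + 1)) K).BlockTriangular _
    exact Matrix.BlockTriangular.mul ha hb
  one_mem' := by
    change ((1 : symplecticGroup (Fin (m + 1)) K) : Matrix (Fin (m + 1) ⊕ Fin (m + 1)) (Fin (m + 1) ⊕ Fin (m + 1)) K).BlockTriangular _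
    exact Matrix.blockTriangular_one
  inv_mem' {a} ha := by
    change ((a⁻¹ : symplecticGroup (Fin (m + 1)) K) : Matrix (Fin (m + 1) ⊕ Fin (m + 1)) (Fin (m + 1) ⊕ Fin (m + 1)) K).BlockTriangular _
    rw [SymplecticGroup.coe_inv']
    haveI := Matrix.invertibleOfIsUnitDet _ (SymplecticGroup.symplectic_det a.2)
    exact Matrix.blockTriangular_inv_of_blockTriangular ha

/-- Membership in `P_K`. [cite: AndrianovZhuravlev1995, Ch. 1 §3 Prop. 3.7] -/
theorem mem_symplecticKlingenParabolic_iff {g : symplecticGroup (Fin (m + 1)) K} :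
    g ∈ symplecticKlingenParabolic m K ↔
      (∀ s, s ≠ Sum.inr 0 → (g : Matrix (Fin (m + 1) ⊕ Fin (m + 1)) (Fin (m + 1) ⊕ Fin (m + 1)) K) s (Sum.inr 0) = 0) ∧ ∀ t, t ≠ Sum.inl 0 → (g : Matrix (Fin (m + 1) ⊕ Fin (m + 1)) (Fin (m + 1) ⊕ Fin (m + 1)) K) (Sum.inl 0) t = 0 :=
  blockTriangular_klingenBlockLabel_iff _

/-- `B(K) ≤ P_K(K)`: `inr 0` is the first and `inl 0` the last index of the Borel order. [cite: AndrianovZhuravlev1995, Ch. 1 §3 Prop. 3.7;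
Ch. 3 §3 Lemma 3.4] -/
theorem symplecticBorel_le_symplecticKlingenParabolic : symplecticBorel (m + 1) K ≤ symplecticKlingenParabolic m K := by
  intro g hg
  rw [mem_symplecticBorel_iff] at hg
  refine mem_symplecticKlingenParabolic_iff.2 ⟨fun s hs => hg ?_, fun t ht => hg ?_⟩
  · rw [symplecticBorelOrder_inr, Fin.val_zero]
    refine Nat.pos_of_ne_zero fun h0 => hs (symplecticBorelOrder_injective ?_)
    rw [h0, symplecticBorelOrder_inr, Fin.val_zero]
  · have hle : symplecticBorelOrder (m + 1) t ≤ 2 * (m + 1) - 1 := by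
      rcases t with i | i
      · rw [symplecticBorelOrder_inl]; omega
      · rw [symplecticBorelOrder_inr]; have := i.isLt; omega
    refine lt_of_le_of_ne (by rw [symplecticBorelOrder_inl, Fin.val_zero]; omega) fun h => ht (symplecticBorelOrder_injective ?_)
    rw [h, symplecticBorelOrder_inl, Fin.val_zero]

omit [Field K] in
/-- **The symplectic pairing in coordinates**: `(M J ᵗN)_{x y} = Σ_j (M_{x, inr j} N_{y, inl j} - M_{x, inl j} N_{y, inr j})`.
[cite: AndrianovZhuravlev1995, Ch. 1 §3 (3.1), (3.5)] -/
theorem mul_J_mul_transpose_apply {R : Type*} [CommRing R] {l : Type*} [Fintype l] [DecidableEq l] (M N : Matrix (l ⊕ l) (l ⊕ l) R)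
    (x y : l ⊕ l) :
    (M * Matrix.J l R * Nᵀ) x y = ∑ j, (M x (Sum.inr j) * N y (Sum.inl j) - M x (Sum.inl j) * N y (Sum.inr j)) := by
  rw [Matrix.mul_assoc, Matrix.mul_apply, Fintype.sum_sum_type, Finset.sum_sub_distrib]
  have hJ : ∀ u v : l ⊕ l, (Matrix.J l R * Nᵀ) u v = Sum.elim (fun i => -N v (Sum.inr i)) (fun i => N v (Sum.inl i)) u := by
    intro u v
    rw [Matrix.mul_apply, Fintype.sum_sum_type]
    rcases u with i | i
    · simp only [Matrix.J, Matrix.fromBlocks_apply₁₁, Matrix.zero_apply, zero_mul, Finset.sum_const_zero, zero_add,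
        Matrix.fromBlocks_apply₁₂, Matrix.neg_apply, Matrix.one_apply, Matrix.transpose_apply, Sum.elim_inl, neg_mul, ite_mul,
        one_mul, Finset.sum_neg_distrib, Finset.sum_ite_eq, Finset.mem_univ, if_true]
    · simp only [Matrix.J, Matrix.fromBlocks_apply₂₁, Matrix.one_apply, Matrix.transpose_apply, ite_mul, one_mul, zero_mul,
        Finset.sum_ite_eq, Finset.mem_univ, if_true, Matrix.fromBlocks_apply₂₂, Matrix.zero_apply, Finset.sum_const_zero, add_zero,
        Sum.elim_inr]
  simp only [hJ, Sum.elim_inl, Sum.elim_inr, mul_neg, Finset.sum_neg_distrib]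
  rw [add_comm, sub_eq_add_neg]

/-- The defining identity of `Sp(J, K)` in coordinates. [cite: AndrianovZhuravlev1995, Ch. 1 §3 (3.5)] -/
theorem sum_apply_inr_mul_apply_inl_sub (g : symplecticGroup (Fin (m + 1)) K) (x y : Fin (m + 1) ⊕ Fin (m + 1)) :
    ∑ j, ((g : Matrix (Fin (m + 1) ⊕ Fin (m + 1)) (Fin (m + 1) ⊕ Fin (m + 1)) K) x (Sum.inr j) * (g : Matrix (Fin (m + 1) ⊕ Fin (m + 1)) (Fin (m + 1) ⊕ Fin (m + 1)) K) y (Sum.inl j) - (g : Matrix (Fin (m + 1) ⊕ Fin (m + 1)) (Fin (m + 1) ⊕ Fin (m + 1)) K) x (Sum.inl j) * (g : Matrix (Fin (m + 1) ⊕ Fin (m + 1)) (Fin (m + 1) ⊕ Fin (m + 1)) K) y (Sum.inr j)) =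
      Matrix.J (Fin (m + 1)) K x y := by
  rw [← mul_J_mul_transpose_apply, SymplecticGroup.mem_iff.1 g.2]

/-- **Corner entries of `P_K`**: `g_{inr 0, inr 0} g_{inl 0, inl 0} = 1`. [cite: AndrianovZhuravlev1995, Ch. 1 §3 Prop. 3.7] -/
theorem apply_inr_zero_mul_apply_inl_zero {g : symplecticGroup (Fin (m + 1)) K} (hg : g ∈ symplecticKlingenParabolic m K) :
    (g : Matrix (Fin (m + 1) ⊕ Fin (m + 1)) (Fin (m + 1) ⊕ Fin (m + 1)) K) (Sum.inr 0) (Sum.inr 0) * (g : Matrix (Fin (m + 1) ⊕ Fin (m + 1)) (Fin (m + 1) ⊕ Fin (m + 1)) K) (Sum.inl 0) (Sum.inl 0) = 1 := by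
  obtain ⟨h1, h2⟩ := mem_symplecticKlingenParabolic_iff.1 hg
  have h := sum_apply_inr_mul_apply_inl_sub g (Sum.inr 0) (Sum.inl 0)
  rw [Fin.sum_univ_succ, Finset.sum_eq_zero fun j _ => ?_] at h
  · rw [h2 (Sum.inr 0) Sum.inr_ne_inl, mul_zero, sub_zero, add_zero, Matrix.J, Matrix.fromBlocks_apply₂₁, Matrix.one_apply_eq] at h
    exact h
  · rw [h2 (Sum.inl j.succ) (by rw [Ne, Sum.inl.injEq]; exact Fin.succ_ne_zero j),
      h2 (Sum.inr j.succ) Sum.inr_ne_inl, mul_zero, mul_zero, sub_zero]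

/-! ## §3 The middle block `P_K → Sp_{2m}(K)` -/

/-- The middle block `M|_{ι × ι}`. [cite: AndrianovZhuravlev1995, Ch. 1 §3 Prop. 3.7] -/
def klingenMid (M : Matrix (Fin (m + 1) ⊕ Fin (m + 1)) (Fin (m + 1) ⊕ Fin (m + 1)) K) : Matrix (Fin m ⊕ Fin m) (Fin m ⊕ Fin m) K :=
  M.submatrix (klingenIndex m) (klingenIndex m)

omit [Field K] in
/-- Entries of the middle block. [cite: AndrianovZhuravlev1995, Ch. 1 §3 Prop. 3.7] -/
@[simp] theorem klingenMid_apply (M : Matrix (Fin (m + 1) ⊕ Fin (m + 1)) (Fin (m + 1) ⊕ Fin (m + 1)) K) (s t : Fin m ⊕ Fin m) :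
    klingenMid M s t = M (klingenIndex m s) (klingenIndex m t) := rfl

/-- `1|_{ι×ι} = 1`. [cite: AndrianovZhuravlev1995, Ch. 1 §3 Prop. 3.7] -/
theorem klingenMid_one : klingenMid (1 : Matrix (Fin (m + 1) ⊕ Fin (m + 1)) (Fin (m + 1) ⊕ Fin (m + 1)) K) = 1 := by
  ext s t
  simp only [klingenMid_apply, Matrix.one_apply, klingenIndex_injective.eq_iff]

/-- **The middle block is multiplicative on `P_K`** (block upper triangular matrices). [cite: CartierCorvallis1979, §IV (4.2)] -/
theorem klingenMid_mul {M M' : Matrix (Fin (m + 1) ⊕ Fin (m + 1)) (Fin (m + 1) ⊕ Fin (m + 1)) K}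
    (hM : M.BlockTriangular (klingenBlockLabel m)) (hM' : M'.BlockTriangular (klingenBlockLabel m)) :
    klingenMid (M * M') = klingenMid M * klingenMid M' := by
  obtain ⟨hM1, -⟩ := (blockTriangular_klingenBlockLabel_iff M).1 hM
  obtain ⟨-, hM'2⟩ := (blockTriangular_klingenBlockLabel_iff M').1 hM'
  ext s t
  rw [klingenMid_apply, Matrix.mul_apply, Matrix.mul_apply, sum_eq_add_add_sum_klingenIndex,
    hM1 _ (klingenIndex_ne_inr_zero s), zero_mul, zero_add, hM'2 _ (klingenIndex_ne_inl_zero t), mul_zero, zero_add]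
  simp only [klingenMid_apply]

/-- **The middle block of an element of `P_K` is symplectic.** [cite: AndrianovZhuravlev1995, Ch. 1 §3 Prop. 3.7] [cite: Satake1963, §7] -/
theorem klingenMid_mem_symplecticGroup {g : symplecticGroup (Fin (m + 1)) K} (hg : g ∈ symplecticKlingenParabolic m K) :
    klingenMid (g : Matrix (Fin (m + 1) ⊕ Fin (m + 1)) (Fin (m + 1) ⊕ Fin (m + 1)) K) ∈ symplecticGroup (Fin m) K := by
  obtain ⟨h1, -⟩ := mem_symplecticKlingenParabolic_iff.1 hg
  rw [SymplecticGroup.mem_iff]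
  ext s t
  rw [mul_J_mul_transpose_apply, ← J_klingenIndex (K := K) s t, ← sum_apply_inr_mul_apply_inl_sub g, Fin.sum_univ_succ,
    h1 _ (klingenIndex_ne_inr_zero s), h1 _ (klingenIndex_ne_inr_zero t), zero_mul, mul_zero, sub_zero, zero_add]
  simp only [klingenMid_apply, klingenIndex_inl, klingenIndex_inr]

/-- Coercions of products in `P_K`. [folklore] -/
private theorem coe_coe_mul_klingen (q q' : symplecticKlingenParabolic m K) :
    (((q * q' : symplecticKlingenParabolic m K) : symplecticGroup (Fin (m + 1)) K) : Matrix (Fin (m + 1) ⊕ Fin (m + 1)) (Fin (m + 1) ⊕ Fin (m + 1)) K) =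
      ((q : symplecticGroup (Fin (m + 1)) K) : Matrix (Fin (m + 1) ⊕ Fin (m + 1)) (Fin (m + 1) ⊕ Fin (m + 1)) K) * ((q' : symplecticGroup (Fin (m + 1)) K) : Matrix (Fin (m + 1) ⊕ Fin (m + 1)) (Fin (m + 1) ⊕ Fin (m + 1)) K) := by
  rw [Subgroup.coe_mul, Submonoid.coe_mul]

/-- **The Levi projection `P_K → Sp_{2m}(K)` onto the middle block.** [cite: AndrianovZhuravlev1995, Ch. 1 §3 Prop. 3.7]
[cite: Satake1963, §7] [cite: BruhatTits1972, (4.4.3)] -/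
def klingenMidSp (m : ℕ) (K : Type*) [Field K] : symplecticKlingenParabolic m K →* symplecticGroup (Fin m) K where
  toFun q := ⟨klingenMid ((q : symplecticGroup (Fin (m + 1)) K) : Matrix (Fin (m + 1) ⊕ Fin (m + 1)) (Fin (m + 1) ⊕ Fin (m + 1)) K), klingenMid_mem_symplecticGroup q.2⟩
  map_one' := Subtype.ext (by
    change klingenMid ((((1 : symplecticKlingenParabolic m K)) : symplecticGroup (Fin (m + 1)) K) : Matrix (Fin (m + 1) ⊕ Fin (m + 1)) (Fin (m + 1) ⊕ Fin (m + 1)) K) = 1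
    rw [Subgroup.coe_one]
    exact klingenMid_one)
  map_mul' q q' := Subtype.ext (by
    change klingenMid (((q * q' : symplecticKlingenParabolic m K) : symplecticGroup (Fin (m + 1)) K) : Matrix (Fin (m + 1) ⊕ Fin (m + 1)) (Fin (m + 1) ⊕ Fin (m + 1)) K) =
      klingenMid ((q : symplecticGroup (Fin (m + 1)) K) : Matrix (Fin (m + 1) ⊕ Fin (m + 1)) (Fin (m + 1) ⊕ Fin (m + 1)) K) * klingenMid ((q' : symplecticGroup (Fin (m + 1)) K) : Matrix (Fin (m + 1) ⊕ Fin (m + 1)) (Fin (m + 1) ⊕ Fin (m + 1)) K)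
    rw [coe_coe_mul_klingen]
    exact klingenMid_mul q.2 q'.2)

/-- The matrix of `klingenMidSp q`. [cite: AndrianovZhuravlev1995, Ch. 1 §3 Prop. 3.7] -/
@[simp] theorem coe_klingenMidSp (q : symplecticKlingenParabolic m K) :
    ((klingenMidSp m K q : symplecticGroup (Fin m) K) : Matrix (Fin m ⊕ Fin m) (Fin m ⊕ Fin m) K) = klingenMid ((q : symplecticGroup (Fin (m + 1)) K) : Matrix (Fin (m + 1) ⊕ Fin (m + 1)) (Fin (m + 1) ⊕ Fin (m + 1)) K) :=
  rfl

/-- Entries of `klingenMidSp q`. [cite: AndrianovZhuravlev1995, Ch. 1 §3 Prop. 3.7] -/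
theorem klingenMidSp_apply (q : symplecticKlingenParabolic m K) (s t : Fin m ⊕ Fin m) :
    ((klingenMidSp m K q : symplecticGroup (Fin m) K) : Matrix (Fin m ⊕ Fin m) (Fin m ⊕ Fin m) K) s t =
      ((q : symplecticGroup (Fin (m + 1)) K) : Matrix (Fin (m + 1) ⊕ Fin (m + 1)) (Fin (m + 1) ⊕ Fin (m + 1)) K) (klingenIndex m s) (klingenIndex m t) :=
  rfl

/-- **The middle block of a Borel element is a Borel element of `Sp_{2m}`** (the Borel orders correspond along `ι`).
[cite: AndrianovZhuravlev1995, Ch. 3 §3 Lemma 3.4] [cite: BruhatTits1972, (4.4.3)] -/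
theorem klingenMidSp_mem_symplecticBorel {p : symplecticGroup (Fin (m + 1)) K} (hp : p ∈ symplecticBorel (m + 1) K) :
    klingenMidSp m K ⟨p, symplecticBorel_le_symplecticKlingenParabolic hp⟩ ∈ symplecticBorel m K := by
  rw [mem_symplecticBorel_iff]
  intro s t hst
  rw [klingenMidSp_apply]
  have h := mem_symplecticBorel_iff.1 hp
  refine h ?_
  rw [symplecticBorelOrder_klingenIndex, symplecticBorelOrder_klingenIndex]
  omega

/-! ## §4 The Klingen lift `L : Sp_{2m}(K) → Sp_{2m+2}(K)`, `g' ↦ diag(1 | g' | 1)` -/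

/-- The matrix `L(M) = diag(1 | M | 1)`: `M` on the middle indices, `1` at the corners `(inl 0, inl 0)`, `(inr 0, inr 0)`, `0`
elsewhere — written with `Fin.cons` along both coordinates of each of the four blocks. [cite: AndrianovZhuravlev1995, Ch. 1 §3 Prop. 3.7] -/
def klingenLiftMatrix (M : Matrix (Fin m ⊕ Fin m) (Fin m ⊕ Fin m) K) :
    Matrix (Fin (m + 1) ⊕ Fin (m + 1)) (Fin (m + 1) ⊕ Fin (m + 1)) K :=
  Matrix.fromBlocks
    (Matrix.of (Fin.cons (Fin.cons 1 0) fun i => Fin.cons 0 fun j => M (Sum.inl i) (Sum.inl j)))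
    (Matrix.of (Fin.cons 0 fun i => Fin.cons 0 fun j => M (Sum.inl i) (Sum.inr j)))
    (Matrix.of (Fin.cons 0 fun i => Fin.cons 0 fun j => M (Sum.inr i) (Sum.inl j)))
    (Matrix.of (Fin.cons (Fin.cons 1 0) fun i => Fin.cons 0 fun j => M (Sum.inr i) (Sum.inr j)))

/-- `L(M)_{ι s, ι t} = M_{s t}`. [cite: AndrianovZhuravlev1995, Ch. 1 §3 Prop. 3.7] -/
@[simp] theorem klingenLiftMatrix_klingenIndex (M : Matrix (Fin m ⊕ Fin m) (Fin m ⊕ Fin m) K) (s t : Fin m ⊕ Fin m) :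
    klingenLiftMatrix M (klingenIndex m s) (klingenIndex m t) = M s t := by
  rcases s with i | i <;> rcases t with j | j <;>
    simp [klingenLiftMatrix, klingenIndex_inl, klingenIndex_inr, Matrix.fromBlocks_apply₁₁, Matrix.fromBlocks_apply₁₂,
      Matrix.fromBlocks_apply₂₁, Matrix.fromBlocks_apply₂₂]

/-- `L(M)_{inl 0, inl 0} = 1`. [cite: AndrianovZhuravlev1995, Ch. 1 §3 Prop. 3.7] -/
@[simp] theorem klingenLiftMatrix_inl_zero_inl_zero (M : Matrix (Fin m ⊕ Fin m) (Fin m ⊕ Fin m) K) :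
    klingenLiftMatrix M (Sum.inl 0) (Sum.inl 0) = 1 := by
  simp [klingenLiftMatrix]

/-- `L(M)_{inr 0, inr 0} = 1`. [cite: AndrianovZhuravlev1995, Ch. 1 §3 Prop. 3.7] -/
@[simp] theorem klingenLiftMatrix_inr_zero_inr_zero (M : Matrix (Fin m ⊕ Fin m) (Fin m ⊕ Fin m) K) :
    klingenLiftMatrix M (Sum.inr 0) (Sum.inr 0) = 1 := by
  simp [klingenLiftMatrix]

/-- `L(M)_{inl 0, inr 0} = 0`. [cite: AndrianovZhuravlev1995, Ch. 1 §3 Prop. 3.7] -/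
@[simp] theorem klingenLiftMatrix_inl_zero_inr_zero (M : Matrix (Fin m ⊕ Fin m) (Fin m ⊕ Fin m) K) :
    klingenLiftMatrix M (Sum.inl 0) (Sum.inr 0) = 0 := by
  simp [klingenLiftMatrix]

/-- `L(M)_{inr 0, inl 0} = 0`. [cite: AndrianovZhuravlev1995, Ch. 1 §3 Prop. 3.7] -/
@[simp] theorem klingenLiftMatrix_inr_zero_inl_zero (M : Matrix (Fin m ⊕ Fin m) (Fin m ⊕ Fin m) K) :
    klingenLiftMatrix M (Sum.inr 0) (Sum.inl 0) = 0 := by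
  simp [klingenLiftMatrix]

/-- `L(M)_{ι s, inl 0} = 0`. [cite: AndrianovZhuravlev1995, Ch. 1 §3 Prop. 3.7] -/
@[simp] theorem klingenLiftMatrix_klingenIndex_inl_zero (M : Matrix (Fin m ⊕ Fin m) (Fin m ⊕ Fin m) K) (s : Fin m ⊕ Fin m) :
    klingenLiftMatrix M (klingenIndex m s) (Sum.inl 0) = 0 := by
  rcases s with i | i <;> simp [klingenLiftMatrix, klingenIndex_inl, klingenIndex_inr]

/-- `L(M)_{ι s, inr 0} = 0`. [cite: AndrianovZhuravlev1995, Ch. 1 §3 Prop. 3.7] -/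
@[simp] theorem klingenLiftMatrix_klingenIndex_inr_zero (M : Matrix (Fin m ⊕ Fin m) (Fin m ⊕ Fin m) K) (s : Fin m ⊕ Fin m) :
    klingenLiftMatrix M (klingenIndex m s) (Sum.inr 0) = 0 := by
  rcases s with i | i <;> simp [klingenLiftMatrix, klingenIndex_inl, klingenIndex_inr]

/-- `L(M)_{inl 0, ι t} = 0`. [cite: AndrianovZhuravlev1995, Ch. 1 §3 Prop. 3.7] -/
@[simp] theorem klingenLiftMatrix_inl_zero_klingenIndex (M : Matrix (Fin m ⊕ Fin m) (Fin m ⊕ Fin m) K) (t : Fin m ⊕ Fin m) :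
    klingenLiftMatrix M (Sum.inl 0) (klingenIndex m t) = 0 := by
  rcases t with j | j <;> simp [klingenLiftMatrix, klingenIndex_inl, klingenIndex_inr]

/-- `L(M)_{inr 0, ι t} = 0`. [cite: AndrianovZhuravlev1995, Ch. 1 §3 Prop. 3.7] -/
@[simp] theorem klingenLiftMatrix_inr_zero_klingenIndex (M : Matrix (Fin m ⊕ Fin m) (Fin m ⊕ Fin m) K) (t : Fin m ⊕ Fin m) :
    klingenLiftMatrix M (Sum.inr 0) (klingenIndex m t) = 0 := by
  rcases t with j | j <;> simp [klingenLiftMatrix, klingenIndex_inl, klingenIndex_inr]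

/-- The row of a corner index of `L(M)` away from the diagonal vanishes: `L(M)_{c, y} = δ_{c y}` for `c ∈ {inl 0, inr 0}`.
[cite: AndrianovZhuravlev1995, Ch. 1 §3 Prop. 3.7] -/
theorem klingenLiftMatrix_corner_apply (M : Matrix (Fin m ⊕ Fin m) (Fin m ⊕ Fin m) K) {c : Fin (m + 1) ⊕ Fin (m + 1)}
    (hc : c = Sum.inl 0 ∨ c = Sum.inr 0) (y : Fin (m + 1) ⊕ Fin (m + 1)) :
    klingenLiftMatrix M c y = if c = y then 1 else 0 := by
  by_cases hy1 : y = Sum.inr 0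
  · subst hy1
    rcases hc with rfl | rfl
    · rw [klingenLiftMatrix_inl_zero_inr_zero, if_neg Sum.inl_ne_inr]
    · rw [klingenLiftMatrix_inr_zero_inr_zero, if_pos rfl]
  by_cases hy2 : y = Sum.inl 0
  · subst hy2
    rcases hc with rfl | rfl
    · rw [klingenLiftMatrix_inl_zero_inl_zero, if_pos rfl]
    · rw [klingenLiftMatrix_inr_zero_inl_zero, if_neg Sum.inr_ne_inl]
  obtain ⟨t, rfl⟩ := exists_klingenIndex_eq hy1 hy2
  rcases hc with rfl | rfl
  · rw [klingenLiftMatrix_inl_zero_klingenIndex, if_neg (klingenIndex_ne_inl_zero t).symm]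
  · rw [klingenLiftMatrix_inr_zero_klingenIndex, if_neg (klingenIndex_ne_inr_zero t).symm]

/-- The column of a corner index: `L(M)_{x, c} = δ_{x c}`. [cite: AndrianovZhuravlev1995, Ch. 1 §3 Prop. 3.7] -/
theorem klingenLiftMatrix_apply_corner (M : Matrix (Fin m ⊕ Fin m) (Fin m ⊕ Fin m) K) (x : Fin (m + 1) ⊕ Fin (m + 1))
    {c : Fin (m + 1) ⊕ Fin (m + 1)} (hc : c = Sum.inl 0 ∨ c = Sum.inr 0) :
    klingenLiftMatrix M x c = if x = c then 1 else 0 := by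
  by_cases hx1 : x = Sum.inr 0
  · subst hx1
    rcases hc with rfl | rfl
    · rw [klingenLiftMatrix_inr_zero_inl_zero, if_neg Sum.inr_ne_inl]
    · rw [klingenLiftMatrix_inr_zero_inr_zero, if_pos rfl]
  by_cases hx2 : x = Sum.inl 0
  · subst hx2
    rcases hc with rfl | rfl
    · rw [klingenLiftMatrix_inl_zero_inl_zero, if_pos rfl]
    · rw [klingenLiftMatrix_inl_zero_inr_zero, if_neg Sum.inl_ne_inr]
  obtain ⟨s, rfl⟩ := exists_klingenIndex_eq hx1 hx2
  rcases hc with rfl | rfl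
  · rw [klingenLiftMatrix_klingenIndex_inl_zero, if_neg (klingenIndex_ne_inl_zero s)]
  · rw [klingenLiftMatrix_klingenIndex_inr_zero, if_neg (klingenIndex_ne_inr_zero s)]

/-- Every index is `inr 0`, `inl 0` or a middle index. [cite: AndrianovZhuravlev1995, Ch. 1 §3 Prop. 3.7] -/
theorem klingen_trichotomy (x : Fin (m + 1) ⊕ Fin (m + 1)) : x = Sum.inr 0 ∨ x = Sum.inl 0 ∨ ∃ s, x = klingenIndex m s := by
  by_cases h1 : x = Sum.inr 0
  · exact Or.inl h1
  by_cases h2 : x = Sum.inl 0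
  · exact Or.inr (Or.inl h2)
  obtain ⟨s, hs⟩ := exists_klingenIndex_eq h1 h2
  exact Or.inr (Or.inr ⟨s, hs.symm⟩)

/-- `J(c, ι t) = 0` for a corner index `c`. [cite: AndrianovZhuravlev1995, Ch. 1 §3 (3.1)] -/
theorem J_corner_klingenIndex {c : Fin (m + 1) ⊕ Fin (m + 1)} (hc : c = Sum.inl 0 ∨ c = Sum.inr 0) (t : Fin m ⊕ Fin m) :
    Matrix.J (Fin (m + 1)) K c (klingenIndex m t) = 0 := by
  rcases hc with rfl | rfl <;> rcases t with j | j
  · rw [klingenIndex_inl, Matrix.J, Matrix.fromBlocks_apply₁₁, Matrix.zero_apply]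
  · rw [klingenIndex_inr, Matrix.J, Matrix.fromBlocks_apply₁₂, Matrix.neg_apply, Matrix.one_apply_ne (Fin.succ_ne_zero j).symm, neg_zero]
  · rw [klingenIndex_inl, Matrix.J, Matrix.fromBlocks_apply₂₁, Matrix.one_apply_ne (Fin.succ_ne_zero j).symm]
  · rw [klingenIndex_inr, Matrix.J, Matrix.fromBlocks_apply₂₂, Matrix.zero_apply]

/-- `J(ι s, c) = 0` for a corner index `c`. [cite: AndrianovZhuravlev1995, Ch. 1 §3 (3.1)] -/
theorem J_klingenIndex_corner (s : Fin m ⊕ Fin m) {c : Fin (m + 1) ⊕ Fin (m + 1)} (hc : c = Sum.inl 0 ∨ c = Sum.inr 0) :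
    Matrix.J (Fin (m + 1)) K (klingenIndex m s) c = 0 := by
  rcases hc with rfl | rfl <;> rcases s with i | i
  · rw [klingenIndex_inl, Matrix.J, Matrix.fromBlocks_apply₁₁, Matrix.zero_apply]
  · rw [klingenIndex_inr, Matrix.J, Matrix.fromBlocks_apply₂₁, Matrix.one_apply_ne (Fin.succ_ne_zero i)]
  · rw [klingenIndex_inl, Matrix.J, Matrix.fromBlocks_apply₁₂, Matrix.neg_apply, Matrix.one_apply_ne (Fin.succ_ne_zero i), neg_zero]
  · rw [klingenIndex_inr, Matrix.J, Matrix.fromBlocks_apply₂₂, Matrix.zero_apply]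

/-- Corner values of `J`: `J(inr 0, inl 0) = 1`, `J(inl 0, inr 0) = -1`, `J(inr 0, inr 0) = J(inl 0, inl 0) = 0`.
[cite: AndrianovZhuravlev1995, Ch. 1 §3 (3.1)] -/
theorem J_corners :
    Matrix.J (Fin (m + 1)) K (Sum.inr 0) (Sum.inl 0) = 1 ∧ Matrix.J (Fin (m + 1)) K (Sum.inl 0) (Sum.inr 0) = -1 ∧
      Matrix.J (Fin (m + 1)) K (Sum.inr 0) (Sum.inr 0) = 0 ∧ Matrix.J (Fin (m + 1)) K (Sum.inl 0) (Sum.inl 0) = 0 := by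
  refine ⟨?_, ?_, ?_, ?_⟩
  · rw [Matrix.J, Matrix.fromBlocks_apply₂₁, Matrix.one_apply_eq]
  · rw [Matrix.J, Matrix.fromBlocks_apply₁₂, Matrix.neg_apply, Matrix.one_apply_eq]
  · rw [Matrix.J, Matrix.fromBlocks_apply₂₂, Matrix.zero_apply]
  · rw [Matrix.J, Matrix.fromBlocks_apply₁₁, Matrix.zero_apply]

/-- **`L(g')` is symplectic for `g' ∈ Sp_{2m}(K)`**: in `(L J ᵗL)_{xy} = Σ_j (…)` the `j = 0` term sees only the corners and the
middle terms reproduce `g' J ᵗg' = J`. [cite: AndrianovZhuravlev1995, Ch. 1 §3 Prop. 3.7] [cite: Satake1963, §7] -/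
theorem klingenLiftMatrix_mem_symplecticGroup (g' : symplecticGroup (Fin m) K) :
    klingenLiftMatrix (g' : Matrix (Fin m ⊕ Fin m) (Fin m ⊕ Fin m) K) ∈ symplecticGroup (Fin (m + 1)) K := by
  have hg' : ∀ s t, ∑ j, ((g' : Matrix (Fin m ⊕ Fin m) (Fin m ⊕ Fin m) K) s (Sum.inr j) * (g' : Matrix (Fin m ⊕ Fin m) (Fin m ⊕ Fin m) K) t (Sum.inl j) -
      (g' : Matrix (Fin m ⊕ Fin m) (Fin m ⊕ Fin m) K) s (Sum.inl j) * (g' : Matrix (Fin m ⊕ Fin m) (Fin m ⊕ Fin m) K) t (Sum.inr j)) = Matrix.J (Fin m) K s t := fun s t => by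
    rw [← mul_J_mul_transpose_apply, SymplecticGroup.mem_iff.1 g'.2]
  obtain ⟨hJ1, hJ2, hJ3, hJ4⟩ := J_corners (m := m) (K := K)
  rw [SymplecticGroup.mem_iff]
  ext x y
  rw [mul_J_mul_transpose_apply, Fin.sum_univ_succ]
  simp only [← klingenIndex_inl, ← klingenIndex_inr]
  obtain (rfl | rfl | ⟨s, rfl⟩) := klingen_trichotomy x <;> obtain (rfl | rfl | ⟨t, rfl⟩) := klingen_trichotomy y <;>
    simp [hJ1, hJ2, hJ3, hJ4, hg', J_klingenIndex, J_corner_klingenIndex, J_klingenIndex_corner]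

/-- `L(1) = 1`. [cite: AndrianovZhuravlev1995, Ch. 1 §3 Prop. 3.7] -/
theorem klingenLiftMatrix_one : klingenLiftMatrix (1 : Matrix (Fin m ⊕ Fin m) (Fin m ⊕ Fin m) K) = 1 := by
  ext x y
  obtain (rfl | rfl | ⟨s, rfl⟩) := klingen_trichotomy x <;> obtain (rfl | rfl | ⟨t, rfl⟩) := klingen_trichotomy y <;>
    simp [Matrix.one_apply, klingenIndex_injective.eq_iff, klingenIndex_ne_inr_zero, klingenIndex_ne_inl_zero,
      (klingenIndex_ne_inr_zero _).symm, (klingenIndex_ne_inl_zero _).symm]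

/-- `L(M N) = L(M) L(N)`. [cite: AndrianovZhuravlev1995, Ch. 1 §3 Prop. 3.7] -/
theorem klingenLiftMatrix_mul (M N : Matrix (Fin m ⊕ Fin m) (Fin m ⊕ Fin m) K) :
    klingenLiftMatrix (M * N) = klingenLiftMatrix M * klingenLiftMatrix N := by
  ext x y
  rw [Matrix.mul_apply, sum_eq_add_add_sum_klingenIndex]
  obtain (rfl | rfl | ⟨s, rfl⟩) := klingen_trichotomy x <;> obtain (rfl | rfl | ⟨t, rfl⟩) := klingen_trichotomy y <;>
    simp [Matrix.mul_apply, klingenIndex_ne_inr_zero, klingenIndex_ne_inl_zero, (klingenIndex_ne_inr_zero _).symm,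
      (klingenIndex_ne_inl_zero _).symm, klingenLiftMatrix_corner_apply, klingenLiftMatrix_apply_corner]

/-- **The Klingen lift `L : Sp_{2m}(K) →* Sp_{2m+2}(K)`, `g' ↦ diag(1 | g' | 1)`** (the `Sp_{2m}`-factor of the Levi
`GL_1 × Sp_{2m}` of `P_K`). [cite: AndrianovZhuravlev1995, Ch. 1 §3 Prop. 3.7] [cite: Satake1963, §7] -/
def klingenLift (m : ℕ) (K : Type*) [Field K] : symplecticGroup (Fin m) K →* symplecticGroup (Fin (m + 1)) K where
  toFun g' := ⟨klingenLiftMatrix (g' : Matrix (Fin m ⊕ Fin m) (Fin m ⊕ Fin m) K), klingenLiftMatrix_mem_symplecticGroup g'⟩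
  map_one' := Subtype.ext (by
    change klingenLiftMatrix (((1 : symplecticGroup (Fin m) K)) : Matrix (Fin m ⊕ Fin m) (Fin m ⊕ Fin m) K) = 1
    exact klingenLiftMatrix_one)
  map_mul' g h := Subtype.ext (by
    change klingenLiftMatrix (((g * h : symplecticGroup (Fin m) K)) : Matrix (Fin m ⊕ Fin m) (Fin m ⊕ Fin m) K) =
      klingenLiftMatrix (g : Matrix (Fin m ⊕ Fin m) (Fin m ⊕ Fin m) K) * klingenLiftMatrix (h : Matrix (Fin m ⊕ Fin m) (Fin m ⊕ Fin m) K)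
    rw [Submonoid.coe_mul]
    exact klingenLiftMatrix_mul _ _)

/-- The matrix of `L(g')`. [cite: AndrianovZhuravlev1995, Ch. 1 §3 Prop. 3.7] -/
theorem coe_klingenLift (g' : symplecticGroup (Fin m) K) :
    ((klingenLift m K g' : symplecticGroup (Fin (m + 1)) K) : Matrix (Fin (m + 1) ⊕ Fin (m + 1)) (Fin (m + 1) ⊕ Fin (m + 1)) K) =
      klingenLiftMatrix (g' : Matrix (Fin m ⊕ Fin m) (Fin m ⊕ Fin m) K) :=
  rfl

/-- `L(g') ∈ P_K`. [cite: AndrianovZhuravlev1995, Ch. 1 §3 Prop. 3.7] -/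
theorem klingenLift_mem_symplecticKlingenParabolic (g' : symplecticGroup (Fin m) K) :
    klingenLift m K g' ∈ symplecticKlingenParabolic m K := by
  refine mem_symplecticKlingenParabolic_iff.2 ⟨fun s hs => ?_, fun t ht => ?_⟩
  · rw [coe_klingenLift, klingenLiftMatrix_apply_corner _ _ (Or.inr rfl), if_neg hs]
  · rw [coe_klingenLift, klingenLiftMatrix_corner_apply _ (Or.inl rfl), if_neg (Ne.symm ht)]

/-- **`L(g')|_{ι×ι} = g'`**: the Levi projection splits the lift. [cite: AndrianovZhuravlev1995, Ch. 1 §3 Prop. 3.7] -/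
theorem klingenMidSp_klingenLift (g' : symplecticGroup (Fin m) K) :
    klingenMidSp m K ⟨klingenLift m K g', klingenLift_mem_symplecticKlingenParabolic g'⟩ = g' :=
  Subtype.ext (Matrix.ext fun s t => by rw [klingenMidSp_apply]; exact klingenLiftMatrix_klingenIndex _ s t)

/-- `L(g')_{inl 0, inl 0} = 1`. [cite: AndrianovZhuravlev1995, Ch. 1 §3 Prop. 3.7] -/
theorem klingenLift_apply_inl_zero (g' : symplecticGroup (Fin m) K) :
    ((klingenLift m K g' : symplecticGroup (Fin (m + 1)) K) : Matrix (Fin (m + 1) ⊕ Fin (m + 1)) (Fin (m + 1) ⊕ Fin (m + 1)) K)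
      (Sum.inl 0) (Sum.inl 0) = 1 :=
  klingenLiftMatrix_inl_zero_inl_zero _

/-- The complementary factor of an Iwasawa decomposition inside `P_K` lies in `P_K`. [cite: BruhatTits1972, (4.4.3)] -/
theorem mem_symplecticKlingenParabolic_of_mul_eq {p b k : symplecticGroup (Fin (m + 1)) K} (hp : p ∈ symplecticKlingenParabolic m K)
    (hb : b ∈ symplecticBorel (m + 1) K) (h : p = b * k) : k ∈ symplecticKlingenParabolic m K := by
  have hk : k = b⁻¹ * p := by rw [h, inv_mul_cancel_left]
  rw [hk]
  exact (symplecticKlingenParabolic m K).mul_mem ((symplecticKlingenParabolic m K).inv_mem (symplecticBorel_le_symplecticKlingenParabolic hb)) hp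

/-! ## §5 Valued fields: integrality and the Iwasawa exponents along `P_K` -/


section Valued

variable [Valued K ℤᵐ⁰]

/-- **`Sp(J, 𝒪) ∩ P_K` projects into `Sp_{2m}(𝒪)`.** [cite: BruhatTits1972, (4.4.3)] [cite: CartierCorvallis1979, §IV.1] -/
theorem klingenMidSp_mem_symplecticInt {q : symplecticKlingenParabolic m K}
    (hq : (q : symplecticGroup (Fin (m + 1)) K) ∈ symplecticInt (Fin (m + 1)) K) : klingenMidSp m K q ∈ symplecticInt (Fin m) K :=
  mem_symplecticInt_iff.2 fun s t => by rw [klingenMidSp_apply]; exact mem_symplecticInt_iff.1 hq _ _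

/-- **`L(g') ∈ Sp(J, 𝒪)` for `g' ∈ Sp_{2m}(𝒪)`.** [cite: BruhatTits1972, (4.4.3)] [cite: CartierCorvallis1979, §IV.1] -/
theorem klingenLift_mem_symplecticInt {g' : symplecticGroup (Fin m) K} (hg' : g' ∈ symplecticInt (Fin m) K) :
    klingenLift m K g' ∈ symplecticInt (Fin (m + 1)) K := by
  refine mem_symplecticInt_iff.2 fun x y => ?_
  rw [coe_klingenLift]
  obtain (rfl | rfl | ⟨s, rfl⟩) := klingen_trichotomy x
  · rw [klingenLiftMatrix_corner_apply _ (Or.inr rfl)]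
    split_ifs
    · rw [map_one]
    · rw [map_zero]; exact zero_le_one
  · rw [klingenLiftMatrix_corner_apply _ (Or.inl rfl)]
    split_ifs
    · rw [map_one]
    · rw [map_zero]; exact zero_le_one
  · obtain (rfl | rfl | ⟨t, rfl⟩) := klingen_trichotomy y
    · rw [klingenLiftMatrix_klingenIndex_inr_zero, map_zero]; exact zero_le_one
    · rw [klingenLiftMatrix_klingenIndex_inl_zero, map_zero]; exact zero_le_one
    · rw [klingenLiftMatrix_klingenIndex]; exact mem_symplecticInt_iff.1 hg' s t

/-- **Unit corners on `Sp(J, 𝒪) ∩ P_K`**: `v(k_{inl 0, inl 0}) = 1` (both corners are integral with product `1`).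
[cite: BruhatTits1972, (4.4.3)] -/
theorem v_apply_inl_zero_eq_one_of_mem {k : symplecticGroup (Fin (m + 1)) K} (hkP : k ∈ symplecticKlingenParabolic m K)
    (hkI : k ∈ symplecticInt (Fin (m + 1)) K) :
    Valued.v ((k : Matrix (Fin (m + 1) ⊕ Fin (m + 1)) (Fin (m + 1) ⊕ Fin (m + 1)) K) (Sum.inl 0) (Sum.inl 0)) = 1 := by
  have h := congrArg Valued.v (apply_inr_zero_mul_apply_inl_zero hkP)
  rw [map_mul, map_one] at h
  have h1 := mem_symplecticInt_iff.1 hkI (Sum.inr 0) (Sum.inr 0)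
  have h2 := mem_symplecticInt_iff.1 hkI (Sum.inl 0) (Sum.inl 0)
  have h3 := mul_le_mul_left h1
    (Valued.v ((k : Matrix (Fin (m + 1) ⊕ Fin (m + 1)) (Fin (m + 1) ⊕ Fin (m + 1)) K) (Sum.inl 0) (Sum.inl 0)))
  rw [h, one_mul] at h3
  exact le_antisymm h2 h3

variable {ϖ : K}

/-- The exponents of the middle block of a Borel element are the shifted exponents: `a^{(m)}(b|_{ι×ι})_i = a(b)_{i+1}`.
[cite: CartierCorvallis1979, §IV (4.2)] [cite: BruhatTits1972, (4.4.3)] -/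
theorem symplecticIwasawaExp_klingenMidSp_of_mem_symplecticBorel (hϖ : Valued.v ϖ = WithZero.exp (-1 : ℤ))
    {b : symplecticGroup (Fin (m + 1)) K} (hb : b ∈ symplecticBorel (m + 1) K) (i : Fin m) :
    symplecticIwasawaExp hϖ (klingenMidSp m K ⟨b, symplecticBorel_le_symplecticKlingenParabolic hb⟩) i =
      symplecticIwasawaExp hϖ b i.succ := by
  rw [symplecticIwasawaExp_of_mem_symplecticBorel hϖ (klingenMidSp_mem_symplecticBorel hb) i,
    symplecticIwasawaExp_of_mem_symplecticBorel hϖ hb i.succ, klingenMidSp_apply, klingenIndex_inl]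

/-- **The Iwasawa exponents along `P_K`, middle part**: `a(p)_{i+1} = a^{(m)}(p|_{ι×ι})_i` for every `p ∈ P_K(K)`.
[cite: CartierCorvallis1979, §IV (4.2), proof of Thm. 4.1 (b)] [cite: BruhatTits1972, (4.4.3)] -/
theorem symplecticIwasawaExp_succ_of_mem_klingen (hϖ : Valued.v ϖ = WithZero.exp (-1 : ℤ)) {p : symplecticGroup (Fin (m + 1)) K}
    (hp : p ∈ symplecticKlingenParabolic m K) (i : Fin m) :
    symplecticIwasawaExp hϖ p i.succ = symplecticIwasawaExp hϖ (klingenMidSp m K ⟨p, hp⟩) i := by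
  obtain ⟨b, k, hb, hk, h⟩ := exists_mem_symplecticBorel_mul_symplecticInt hϖ p
  have hkP : k ∈ symplecticKlingenParabolic m K := mem_symplecticKlingenParabolic_of_mul_eq hp hb h
  subst h
  have hprod : (⟨b * k, hp⟩ : symplecticKlingenParabolic m K) =
      ⟨b, symplecticBorel_le_symplecticKlingenParabolic hb⟩ * ⟨k, hkP⟩ := rfl
  rw [symplecticIwasawaExp_mul_of_mem_symplecticInt hϖ b hk, hprod, map_mul,
    symplecticIwasawaExp_mul_of_mem_symplecticInt hϖ _ (klingenMidSp_mem_symplecticInt hk),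
    symplecticIwasawaExp_klingenMidSp_of_mem_symplecticBorel hϖ hb]

/-- **The Iwasawa exponents along `P_K`, corner part**: `v(p_{inl 0, inl 0}) = exp(-a(p)_0)` for every `p ∈ P_K(K)`.
[cite: CartierCorvallis1979, §IV (4.2), proof of Thm. 4.1 (b)] [cite: BruhatTits1972, (4.4.3)] -/
theorem v_apply_inl_zero_of_mem_klingen (hϖ : Valued.v ϖ = WithZero.exp (-1 : ℤ)) {p : symplecticGroup (Fin (m + 1)) K}
    (hp : p ∈ symplecticKlingenParabolic m K) :
    Valued.v ((p : Matrix (Fin (m + 1) ⊕ Fin (m + 1)) (Fin (m + 1) ⊕ Fin (m + 1)) K) (Sum.inl 0) (Sum.inl 0)) =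
      WithZero.exp (-symplecticIwasawaExp hϖ p 0) := by
  obtain ⟨b, k, hb, hk, h⟩ := exists_mem_symplecticBorel_mul_symplecticInt hϖ p
  have hkP : k ∈ symplecticKlingenParabolic m K := mem_symplecticKlingenParabolic_of_mul_eq hp hb h
  have hrow := (mem_symplecticKlingenParabolic_iff.1 (symplecticBorel_le_symplecticKlingenParabolic hb)).2
  have hentry : ((b * k : symplecticGroup (Fin (m + 1)) K) : Matrix (Fin (m + 1) ⊕ Fin (m + 1)) (Fin (m + 1) ⊕ Fin (m + 1)) K)
      (Sum.inl 0) (Sum.inl 0) =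
      (b : Matrix (Fin (m + 1) ⊕ Fin (m + 1)) (Fin (m + 1) ⊕ Fin (m + 1)) K) (Sum.inl 0) (Sum.inl 0) *
        (k : Matrix (Fin (m + 1) ⊕ Fin (m + 1)) (Fin (m + 1) ⊕ Fin (m + 1)) K) (Sum.inl 0) (Sum.inl 0) := by
    rw [Submonoid.coe_mul, Matrix.mul_apply, sum_eq_add_add_sum_klingenIndex, hrow _ Sum.inr_ne_inl, zero_mul, zero_add,
      Finset.sum_eq_zero fun u _ => ?_, add_zero]
    rw [hrow _ (klingenIndex_ne_inl_zero u), zero_mul]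
  rw [← v_apply_inl_eq_exp_neg hϖ hb hk h 0, h, hentry, map_mul, v_apply_inl_zero_eq_one_of_mem hkP hk, mul_one]

/-- **THE IWASAWA EXPONENTS FACTOR ALONG THE KLINGEN PARABOLIC**: for `p ∈ P_K(K)`,
`a(p) = (ord p_{inl 0, inl 0}; a^{(m)}(p|_{ι×ι}))`. [cite: CartierCorvallis1979, §IV (4.2), proof of Thm. 4.1 (b)] [cite: Satake1963, §7]
[cite: BruhatTits1972, (4.4.3)] -/
theorem symplecticIwasawaExp_eq_cons_of_mem_klingen (hϖ : Valued.v ϖ = WithZero.exp (-1 : ℤ)) {p : symplecticGroup (Fin (m + 1)) K}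
    (hp : p ∈ symplecticKlingenParabolic m K) :
    symplecticIwasawaExp hϖ p =
      Fin.cons (-WithZero.log (Valued.v ((p : Matrix (Fin (m + 1) ⊕ Fin (m + 1)) (Fin (m + 1) ⊕ Fin (m + 1)) K) (Sum.inl 0) (Sum.inl 0))))
        (symplecticIwasawaExp hϖ (klingenMidSp m K ⟨p, hp⟩)) := by
  funext i
  refine Fin.cases ?_ (fun j => ?_) i
  · rw [Fin.cons_zero, v_apply_inl_zero_of_mem_klingen hϖ hp, WithZero.log_exp, neg_neg]
  · rw [Fin.cons_succ, symplecticIwasawaExp_succ_of_mem_klingen hϖ hp]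

end Valued

end Literature.NumberTheory.Automorphic.SymplecticCartan

end
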